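import Mathlib.FieldTheory.KummerPolynomial
import Mathlib.Algebra.Polynomial.SpecificDegree
import Mathlib.FieldTheory.Galois.Basic
import Mathlib.FieldTheory.IsAlgClosed.Basic
import Mathlib.FieldTheory.IntermediateField.Adjoin.Basic
import Mathlib.GroupTheory.SpecificGroups.Cyclic
import Mathlib.GroupTheory.Perm.Cycle.Type
import Mathlib.Data.ZMod.QuotientGroup
import HarnessLib

/-!
# The Kummer extension `F(√−3, ∛e)` with `N(e)` a cube is abelian sextic over `F`, with a cyclic cubic subfield

Topic `NumberTheory/NumberFields` (Kummer theory; pure field theory).  Theorem-only file.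

Let `F` be a field of characteristic `0` not containing `√−3`, `M = F(λ)`, `λ² = −3`, and
`e = p + qλ ∈ M` (`p, q ∈ F`) an element which is NOT a cube in `M` but whose norm
`e·ē = p² + 3q² = m³` IS a cube in `F`.  Then `N = F(λ, y)`, `y³ = e`, is Galois over `F` of degree
`6` with ABELIAN Galois group (so `N/F` is cyclic sextic and has a unique cubic subfield `E`, cyclic
over `F`).  This is the `ℓ = 3` case of the classical descent criterion of Kummer theory: for
`M = F(ζ_ℓ)` with `Δ = Gal(M/F)` and cyclotomic character `ω`, the Kummer extension `M(ℓ√e)/F` is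
abelian iff `δ(e) ≡ e^{ω(δ)} (mod M^{×ℓ})` for `δ ∈ Δ` — here `Δ = {1, τ}`, `ω(τ) = −1`, and
`τ(e) = ē = m³/e ≡ e⁻¹`.  It is the mechanism behind Scholz's reflection theorem (Washington,
*Introduction to Cyclotomic Fields*, proof of Thm 10.10: the unramified cyclic cubic extensions of
`ℚ(√−3d)` are the cubic subfields of the `K(∛β)`, `K = ℚ(√d, ζ₃)`, with `β` in the eigenspace where
`Gal(K/ℚ(√−3d))` acts through `ω`; the real unit `ε` of `ℚ(√d)` lies there since `ε·ε' = ±1`).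

Main statements (`F ⊆ L` fields, `CharZero F`, `λ, y ∈ L`; namespace `KummerSextic`):

* `cube_eq_one_iff` — `ω³ = 1` iff `ω = 1` or `2ω + 1 = ±λ`; `exists_coords_of_cube_eq_one` — such
  `ω = u + vλ` with `(u + vλ)(u − vλ) = 1`;
* `mem_adjoin_pair_of_root` — every root of `Q = (X² + 3)(X⁶ − 2pX³ + m³)` lies in `F(λ, y)`, so
  `F(λ, y)` is generated by the root set of `Q` (`adjoin_pair_eq_adjoin_rootSet`) and is Galois
  over `F` (`isGalois_adjoin_pair`, stated for `L` algebraically closed);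
* `finrank_adjoin_pair` — `[F(λ, y) : F] = 6` (`finrank_adjoin_lam` : `[F(λ) : F] = 2`,
  `finrank_adjoin_lam_top` : `[F(λ, y) : F(λ)] = 3`, and `adjoin_adjoin_lam_y_eq_top` : inside
  `N = F(λ, y)` one has `F(λ')(y') = N`, the Kummer presentation over `M = F(λ)`);
* `gal_apply_gens` — an `F`-automorphism acts on the generators by `λ ↦ ±λ`, `y ↦ ωy` or `ω·m/y`;
* `mul_comm_gal` — **`Gal(F(λ, y)/F)` is abelian**;
* `exists_cubic_galois_intermediateField` — **there is an intermediate field `E`, Galois of degree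
  `3` over `F`** (the fixed field of a subgroup of order `2`).

## References

* L. C. Washington, *Introduction to Cyclotomic Fields*, GTM 83, 2nd ed. (1997), §10.2, proof of
  Thm 10.10 (not held; paraphrased). [Washington1997]
* H. Cohen, *Advanced Topics in Computational Number Theory*, GTM 193 (2000), §10.2.3 (Kummer
  theory when `ζ_ℓ ∉ K`: the `T`-eigenspace descent condition), for the general criterion. [Cohen2000]
-/

noncomputable section

open Polynomial IntermediateField Module

namespace Literature.NumberTheory.NumberFields

namespace KummerSextic

variable {F L : Type*} [Field F] [Field L] [Algebra F L]

/-! ### Cube roots of unity in terms of `λ = √−3` -/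

/-- In a field with `λ² = −3` and `2 ≠ 0`: `ω³ = 1` iff `ω = 1 ∨ 2ω + 1 = λ ∨ 2ω + 1 = −λ`. [folklore] -/
theorem cube_eq_one_iff {lam ω : L} (hlam : lam ^ 2 = -3) (h2 : (2 : L) ≠ 0) :
    ω ^ 3 = 1 ↔ ω = 1 ∨ 2 * ω + 1 = lam ∨ 2 * ω + 1 = -lam := by
  constructor
  · intro h
    have h1 : (ω - 1) * ((2 * ω + 1) ^ 2 - lam ^ 2) = 0 := by
      rw [hlam]; linear_combination (4 : L) * h
    rcases mul_eq_zero.mp h1 with h1 | h1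
    · exact Or.inl (sub_eq_zero.mp h1)
    · rw [sq_sub_sq, mul_eq_zero] at h1
      rcases h1 with h1 | h1
      · exact Or.inr (Or.inr (by linear_combination h1))
      · exact Or.inr (Or.inl (sub_eq_zero.mp h1))
  · rintro (rfl | h | h)
    · exact one_pow 3
    · have hω : ω = (lam - 1) / 2 := by field_simp; linear_combination h
      rw [hω, div_pow]; field_simp
      linear_combination (lam - 3) * hlam
    · have hω : ω = (-lam - 1) / 2 := by field_simp; linear_combination h
      rw [hω, div_pow]; field_simp
      linear_combination (-lam - 3) * hlam

/-- A cube root of unity is `u + vλ` with `u, v` RATIONAL over the prime field — concretely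
`(u, v) ∈ {(1, 0), (−1/2, 1/2), (−1/2, −1/2)}` — and `u² + 3v² = 1` (so its `λ`-conjugate is its
inverse). Stated with `u, v ∈ F`. [folklore] -/
theorem exists_coords_of_cube_eq_one [CharZero F] [CharZero L] {lam ω : L} (hlam : lam ^ 2 = -3)
    (hω : ω ^ 3 = 1) :
    ∃ u v : F, ω = algebraMap F L u + algebraMap F L v * lam ∧ u ^ 2 + 3 * v ^ 2 = 1 := by
  have h2 : (2 : L) ≠ 0 := two_ne_zero
  rcases (cube_eq_one_iff hlam h2).mp hω with rfl | h | h
  · exact ⟨1, 0, by simp, by ring⟩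
  · refine ⟨-1/2, 1/2, ?_, by norm_num⟩
    simp only [map_div₀, map_neg, map_one, map_ofNat]
    linear_combination h / 2
  · refine ⟨-1/2, -1/2, ?_, by norm_num⟩
    simp only [map_div₀, map_neg, map_one, map_ofNat]
    linear_combination h / 2

/-! ### The set-up: `λ² = −3`, `λ ∉ F`, `y³ = e = p + qλ`, `e ē = m³`, `e` not a cube in `F(λ)` -/

section Setup

variable {lam y : L} {p q m : F}

/-- `λ ≠ 0`. [folklore] -/
theorem lam_ne_zero [CharZero L] (hlam : lam ^ 2 = -3) : lam ≠ 0 := by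
  rintro rfl; norm_num at hlam

/-- `e = p + qλ ≠ 0` (it is not a cube in `F(λ) ∋ 0`). [folklore] -/
theorem e_ne_zero (hcube : ∀ c ∈ F⟮lam⟯, c ^ 3 ≠ algebraMap F L p + algebraMap F L q * lam) :
    algebraMap F L p + algebraMap F L q * lam ≠ 0 := fun h =>
  hcube 0 (zero_mem _) (by rw [h]; ring)

/-- `ē = p − qλ ≠ 0` (else `λ = p/q ∈ F`, or `e = 0`). [folklore] -/
theorem ebar_ne_zero (hlamF : ∀ x : F, algebraMap F L x ≠ lam)
    (hcube : ∀ c ∈ F⟮lam⟯, c ^ 3 ≠ algebraMap F L p + algebraMap F L q * lam) :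
    algebraMap F L p - algebraMap F L q * lam ≠ 0 := by
  intro h
  by_cases hq : q = 0
  · apply e_ne_zero hcube
    rw [hq, map_zero, zero_mul, sub_zero] at h
    rw [h, hq, map_zero, zero_mul, add_zero]
  · apply hlamF (p / q)
    rw [map_div₀, div_eq_iff ((_root_.map_ne_zero _).mpr hq)]
    linear_combination h

/-- `e · ē = m³`. [folklore] -/
theorem e_mul_ebar (hlam : lam ^ 2 = -3) (hnorm : p ^ 2 + 3 * q ^ 2 = m ^ 3) :
    (algebraMap F L p + algebraMap F L q * lam) * (algebraMap F L p - algebraMap F L q * lam) =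
      algebraMap F L m ^ 3 := by
  have h := congrArg (algebraMap F L) hnorm
  rw [map_add, map_pow, map_mul, map_pow, map_ofNat, map_pow] at h
  linear_combination h - (algebraMap F L q) ^ 2 * hlam

/-- `y ≠ 0`. [folklore] -/
theorem y_ne_zero (hy : y ^ 3 = algebraMap F L p + algebraMap F L q * lam)
    (hcube : ∀ c ∈ F⟮lam⟯, c ^ 3 ≠ algebraMap F L p + algebraMap F L q * lam) : y ≠ 0 := by
  rintro rfl
  exact e_ne_zero hcube (by rw [← hy]; ring)

/-- `(m/y)³ = ē`: the "other" cube roots. [folklore] -/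
theorem m_div_y_pow_three (hlam : lam ^ 2 = -3)
    (hy : y ^ 3 = algebraMap F L p + algebraMap F L q * lam) (hnorm : p ^ 2 + 3 * q ^ 2 = m ^ 3)
    (hcube : ∀ c ∈ F⟮lam⟯, c ^ 3 ≠ algebraMap F L p + algebraMap F L q * lam) :
    (algebraMap F L m / y) ^ 3 = algebraMap F L p - algebraMap F L q * lam := by
  have hy0 := y_ne_zero hy hcube
  have he0 := e_ne_zero hcube
  rw [div_pow, ← e_mul_ebar hlam hnorm, ← hy]
  field_simp

/-- **The roots of the sextic `X⁶ − 2pX³ + m³ = (X³ − e)(X³ − ē)`**: `r³ = e` or `r³ = ē`. [folklore] -/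
theorem pow_three_eq_or_of_sextic (hlam : lam ^ 2 = -3) (hnorm : p ^ 2 + 3 * q ^ 2 = m ^ 3) {r : L}
    (hr : r ^ 6 - 2 * algebraMap F L p * r ^ 3 + algebraMap F L m ^ 3 = 0) :
    r ^ 3 = algebraMap F L p + algebraMap F L q * lam ∨
      r ^ 3 = algebraMap F L p - algebraMap F L q * lam := by
  have h : (r ^ 3 - (algebraMap F L p + algebraMap F L q * lam)) *
      (r ^ 3 - (algebraMap F L p - algebraMap F L q * lam)) = 0 := by
    rw [← hr]; linear_combination e_mul_ebar hlam hnorm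
  rcases mul_eq_zero.mp h with h | h
  · exact Or.inl (sub_eq_zero.mp h)
  · exact Or.inr (sub_eq_zero.mp h)

/-- Two cube roots of the same nonzero element differ by a cube root of unity. [folklore] -/
theorem exists_cube_root_one_mul {r t : L} (ht : t ≠ 0) (h : r ^ 3 = t ^ 3) :
    ∃ ω : L, ω ^ 3 = 1 ∧ r = ω * t :=
  ⟨r / t, by rw [div_pow, h, div_self (pow_ne_zero 3 ht)], by rw [div_mul_cancel₀ _ ht]⟩

/-- Cube roots of unity lie in `F(λ)`. [folklore] -/
theorem mem_adjoin_lam_of_cube_eq_one [CharZero F] [CharZero L] (hlam : lam ^ 2 = -3) {ω : L}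
    (hω : ω ^ 3 = 1) :
    ω ∈ F⟮lam⟯ := by
  obtain ⟨u, v, rfl, -⟩ := exists_coords_of_cube_eq_one (F := F) hlam hω
  exact add_mem (IntermediateField.algebraMap_mem _ u)
    (mul_mem (IntermediateField.algebraMap_mem _ v) (mem_adjoin_simple_self F lam))

/-- `F(λ) ≤ F(λ, y)`. [folklore] -/
theorem adjoin_lam_le : F⟮lam⟯ ≤ F⟮lam, y⟯ :=
  adjoin.mono F _ _ (Set.singleton_subset_iff.mpr (Set.mem_insert _ _))

/-- **Every root of `(X² + 3)(X⁶ − 2pX³ + m³)` lies in `F(λ, y)`**: `±λ`, `ωy`, `ω m/y`.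
[folklore] -/
theorem mem_adjoin_pair_of_root [CharZero F] [CharZero L] (hlam : lam ^ 2 = -3)
    (hlamF : ∀ x : F, algebraMap F L x ≠ lam)
    (hy : y ^ 3 = algebraMap F L p + algebraMap F L q * lam) (hnorm : p ^ 2 + 3 * q ^ 2 = m ^ 3)
    (hcube : ∀ c ∈ F⟮lam⟯, c ^ 3 ≠ algebraMap F L p + algebraMap F L q * lam) {r : L}
    (hr : (r ^ 2 + 3) * (r ^ 6 - 2 * algebraMap F L p * r ^ 3 + algebraMap F L m ^ 3) = 0) :
    r ∈ F⟮lam, y⟯ := by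
  have hlam_mem : lam ∈ F⟮lam, y⟯ := subset_adjoin F _ (Set.mem_insert _ _)
  have hy_mem : y ∈ F⟮lam, y⟯ := subset_adjoin F _ (Set.mem_insert_of_mem _ rfl)
  rcases mul_eq_zero.mp hr with hr | hr
  · -- `r = ±λ`
    have h : (r - lam) * (r + lam) = 0 := by linear_combination hr - hlam
    rcases mul_eq_zero.mp h with h | h
    · rw [sub_eq_zero.mp h]; exact hlam_mem
    · rw [eq_neg_of_add_eq_zero_left h]; exact neg_mem hlam_mem
  · rcases pow_three_eq_or_of_sextic hlam hnorm hr with h3 | h3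
    · -- `r³ = e = y³`
      obtain ⟨ω, hω, rfl⟩ := exists_cube_root_one_mul (y_ne_zero hy hcube) (h3.trans hy.symm)
      exact mul_mem (adjoin_lam_le (mem_adjoin_lam_of_cube_eq_one hlam hω)) hy_mem
    · -- `r³ = ē = (m/y)³`
      have hmy := m_div_y_pow_three hlam hy hnorm hcube
      have hmy0 : algebraMap F L m / y ≠ 0 := by
        intro h0
        rw [h0, zero_pow three_ne_zero] at hmy
        exact ebar_ne_zero hlamF hcube hmy.symm
      obtain ⟨ω, hω, rfl⟩ := exists_cube_root_one_mul hmy0 (h3.trans hmy.symm)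
      exact mul_mem (adjoin_lam_le (mem_adjoin_lam_of_cube_eq_one hlam hω))
        (div_mem (IntermediateField.algebraMap_mem _ m) hy_mem)

/-! ### `F(λ, y)` is the splitting field of `(X² + 3)(X⁶ − 2pX³ + m³)` -/

/-- `X⁶ − 2pX³ + m³` is monic. [folklore] -/
theorem monic_sextic (p m : F) : (X ^ 6 - C (2 * p) * X ^ 3 + C (m ^ 3) : F[X]).Monic := by
  have h : (X ^ 6 - C (2 * p) * X ^ 3 + C (m ^ 3) : F[X]) = X ^ 6 + (-(C (2 * p) * X ^ 3) + C (m ^ 3)) := by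
    ring
  rw [h]
  refine (monic_X_pow 6).add_of_left (lt_of_le_of_lt (degree_add_le _ _) (max_lt ?_ ?_))
  · rw [degree_neg, degree_X_pow]
    exact (degree_C_mul_X_pow_le 3 _).trans_lt (by norm_num)
  · rw [degree_X_pow]; exact degree_C_le.trans_lt (by norm_num)

/-- The auxiliary polynomial `Q = (X² + 3)(X⁶ − 2pX³ + m³)` is nonzero. [folklore] -/
theorem Q_ne_zero (p m : F) :
    ((X ^ 2 + C 3) * (X ^ 6 - C (2 * p) * X ^ 3 + C (m ^ 3)) : F[X]) ≠ 0 :=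
  mul_ne_zero (X_pow_add_C_ne_zero (by norm_num) 3) (monic_sextic p m).ne_zero

/-- Evaluation of `Q`. [folklore] -/
theorem aeval_Q (p m : F) (r : L) :
    aeval r ((X ^ 2 + C 3) * (X ^ 6 - C (2 * p) * X ^ 3 + C (m ^ 3)) : F[X]) =
      (r ^ 2 + 3) * (r ^ 6 - 2 * algebraMap F L p * r ^ 3 + algebraMap F L m ^ 3) := by
  simp only [map_mul, map_add, map_sub, map_pow, aeval_X, aeval_C, map_ofNat]

/-- **`F(λ, y)` is the field generated by the roots of `Q`** (so it is a splitting field of `Q`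
over `F`). [folklore] -/
theorem adjoin_pair_eq_adjoin_rootSet [CharZero F] [CharZero L] (hlam : lam ^ 2 = -3)
    (hlamF : ∀ x : F, algebraMap F L x ≠ lam)
    (hy : y ^ 3 = algebraMap F L p + algebraMap F L q * lam) (hnorm : p ^ 2 + 3 * q ^ 2 = m ^ 3)
    (hcube : ∀ c ∈ F⟮lam⟯, c ^ 3 ≠ algebraMap F L p + algebraMap F L q * lam) :
    F⟮lam, y⟯ = adjoin F (((X ^ 2 + C 3) * (X ^ 6 - C (2 * p) * X ^ 3 + C (m ^ 3)) : F[X]).rootSet L) := by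
  apply le_antisymm
  · apply adjoin.mono
    intro r hr
    rw [mem_rootSet_of_ne (Q_ne_zero p m), aeval_Q]
    simp only [Set.mem_insert_iff, Set.mem_singleton_iff] at hr
    rcases hr with rfl | rfl
    · rw [hlam]; ring
    · rw [show r ^ 6 = (r ^ 3) ^ 2 by ring, hy]
      linear_combination (-(r ^ 2 + 3)) * (e_mul_ebar hlam hnorm)
  · refine adjoin_le_iff.mpr fun r hr => ?_
    rw [mem_rootSet_of_ne (Q_ne_zero p m), aeval_Q] at hr
    exact mem_adjoin_pair_of_root hlam hlamF hy hnorm hcube hr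

/-! ### Integrality, the minimal polynomial of `λ`, `[F(λ) : F] = 2` -/

omit [Algebra F L] in
/-- `X² + 3` is monic of degree `2`. [folklore] -/
theorem monic_X_sq_add_three : (X ^ 2 + C 3 : F[X]).Monic := monic_X_pow_add_C 3 (by norm_num)

/-- `λ` is integral over `F`. [folklore] -/
theorem isIntegral_lam (hlam : lam ^ 2 = -3) : IsIntegral F lam :=
  ⟨X ^ 2 + C 3, monic_X_sq_add_three, by simp [hlam, map_ofNat]⟩

/-- `y` is integral over `F` (a root of the monic sextic). [folklore] -/
theorem isIntegral_y (hlam : lam ^ 2 = -3)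
    (hy : y ^ 3 = algebraMap F L p + algebraMap F L q * lam) (hnorm : p ^ 2 + 3 * q ^ 2 = m ^ 3) :
    IsIntegral F y := by
  refine ⟨X ^ 6 - C (2 * p) * X ^ 3 + C (m ^ 3), monic_sextic p m, ?_⟩
  rw [← aeval_def]
  simp only [map_add, map_sub, map_mul, map_pow, aeval_X, aeval_C, map_ofNat]
  rw [show y ^ 6 = (y ^ 3) ^ 2 by ring, hy]
  linear_combination (-1 : L) * (e_mul_ebar hlam hnorm)

/-- **The minimal polynomial of `λ` is `X² + 3`** (it has no root in `F` since `λ ∉ F`). [folklore] -/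
theorem minpoly_lam (hlam : lam ^ 2 = -3) (hlamF : ∀ x : F, algebraMap F L x ≠ lam) :
    minpoly F lam = X ^ 2 + C 3 := by
  symm
  apply minpoly.eq_of_irreducible_of_monic _ (by simp [hlam, map_ofNat]) monic_X_sq_add_three
  refine irreducible_of_degree_le_three_of_not_isRoot
    (by rw [natDegree_X_pow_add_C]; decide) fun x hx => ?_
  rw [IsRoot.def, eval_add, eval_pow, eval_X, eval_C] at hx
  have h : (algebraMap F L x - lam) * (algebraMap F L x + lam) = 0 := by
    have := congrArg (algebraMap F L) hx
    rw [map_add, map_pow, map_ofNat, map_zero] at this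
    linear_combination this - hlam
  rcases mul_eq_zero.mp h with h | h
  · exact hlamF x (sub_eq_zero.mp h)
  · exact hlamF (-x) (by rw [map_neg]; linear_combination -h)

/-- **`[F(λ) : F] = 2`.** [folklore] -/
theorem finrank_adjoin_lam (hlam : lam ^ 2 = -3) (hlamF : ∀ x : F, algebraMap F L x ≠ lam) :
    finrank F F⟮lam⟯ = 2 := by
  rw [adjoin.finrank (isIntegral_lam hlam), minpoly_lam hlam hlamF, natDegree_X_pow_add_C]

/-! ### Galois -/

/-- `F(λ, y)` is finite-dimensional over `F`. [folklore] -/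
theorem finiteDimensional_adjoin_pair (hlam : lam ^ 2 = -3)
    (hy : y ^ 3 = algebraMap F L p + algebraMap F L q * lam) (hnorm : p ^ 2 + 3 * q ^ 2 = m ^ 3) :
    FiniteDimensional F F⟮lam, y⟯ := by
  apply IntermediateField.finiteDimensional_adjoin
  intro x hx
  simp only [Set.mem_insert_iff, Set.mem_singleton_iff] at hx
  rcases hx with rfl | rfl
  · exact isIntegral_lam hlam
  · exact isIntegral_y hlam hy hnorm

/-- **`F(λ, y)/F` is Galois** (a splitting field in characteristic `0`; the ambient field `L` is
taken algebraically closed so that `Q` splits in it). [folklore] -/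
theorem isGalois_adjoin_pair [IsAlgClosed L] [CharZero F] [CharZero L] (hlam : lam ^ 2 = -3)
    (hlamF : ∀ x : F, algebraMap F L x ≠ lam)
    (hy : y ^ 3 = algebraMap F L p + algebraMap F L q * lam) (hnorm : p ^ 2 + 3 * q ^ 2 = m ^ 3)
    (hcube : ∀ c ∈ F⟮lam⟯, c ^ 3 ≠ algebraMap F L p + algebraMap F L q * lam) :
    IsGalois F F⟮lam, y⟯ := by
  set Q : F[X] := (X ^ 2 + C 3) * (X ^ 6 - C (2 * p) * X ^ 3 + C (m ^ 3)) with hQ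
  have hsplit : (Q.map (algebraMap F L)).Splits := IsAlgClosed.splits _
  haveI : IsSplittingField F (adjoin F (Q.rootSet L)) Q := adjoin_rootSet_isSplittingField hsplit
  have hnormal : Normal F (adjoin F (Q.rootSet L)) := Normal.of_isSplittingField Q
  rw [hQ, ← adjoin_pair_eq_adjoin_rootSet hlam hlamF hy hnorm hcube] at hnormal
  haveI := finiteDimensional_adjoin_pair hlam hy hnorm
  haveI : Algebra.IsSeparable F F⟮lam, y⟯ := Algebra.IsAlgebraic.isSeparable_of_perfectField
  exact isGalois_iff.mpr ⟨inferInstance, hnormal⟩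

/-! ### Inside `N = F(λ, y)`: the Kummer presentation over `M = F(λ)` and `[N : F] = 6` -/

/-- `λ ∈ F(λ, y)`. [folklore] -/
theorem lam_mem : lam ∈ F⟮lam, y⟯ := subset_adjoin F _ (Set.mem_insert _ _)

/-- `y ∈ F(λ, y)`. [folklore] -/
theorem y_mem : y ∈ F⟮lam, y⟯ := subset_adjoin F _ (Set.mem_insert_of_mem _ rfl)

/-- The internal generators generate: `F(λ', y') = ⊤` inside `N = F(λ, y)`. [folklore] -/
theorem adjoin_internal_eq_top :
    adjoin F ({⟨lam, lam_mem⟩, ⟨y, y_mem⟩} : Set F⟮lam, y⟯) = ⊤ := by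
  apply lift_injective
  rw [lift_adjoin, lift_top, Set.image_pair]

/-- **The Kummer presentation over `M = F(λ')`**: `M(y') = N` (as intermediate fields of `N/M`).
[folklore] -/
theorem adjoin_adjoin_lam_y_eq_top :
    adjoin (F⟮(⟨lam, lam_mem⟩ : F⟮lam, y⟯)⟯) {(⟨y, y_mem⟩ : F⟮lam, y⟯)} = ⊤ := by
  apply restrictScalars_injective F
  rw [restrictScalars_top, adjoin_simple_adjoin_simple]
  exact adjoin_internal_eq_top

/-- `[F(λ') : F] = 2` for the internal `λ'`. [folklore] -/
theorem finrank_adjoin_lam_internal (hlam : lam ^ 2 = -3) (hlamF : ∀ x : F, algebraMap F L x ≠ lam) :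
    finrank F (F⟮(⟨lam, lam_mem⟩ : F⟮lam, y⟯)⟯) = 2 := by
  have hint : IsIntegral F (⟨lam, lam_mem⟩ : F⟮lam, y⟯) :=
    IntermediateField.isIntegral_iff.mpr (isIntegral_lam hlam)
  rw [adjoin.finrank hint, IntermediateField.minpoly_eq]
  show (minpoly F lam).natDegree = 2
  rw [minpoly_lam hlam hlamF, natDegree_X_pow_add_C]

/-- Elements of `M = F(λ') ⊆ N` are, as elements of `L`, in `F(λ)`. [folklore] -/
theorem coe_mem_adjoin_lam_of_mem {x : F⟮lam, y⟯}
    (hx : x ∈ F⟮(⟨lam, lam_mem⟩ : F⟮lam, y⟯)⟯) : (x : L) ∈ F⟮lam⟯ := by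
  have h := (mem_lift x).mpr hx
  rwa [lift_adjoin_simple] at h

/-- **`[N : M] = 3`**: the minimal polynomial of `y'` over `M = F(λ')` is `X³ − e`, irreducible
because `e` is not a cube in `F(λ)`. [folklore] -/
theorem finrank_adjoin_lam_top
    (hy : y ^ 3 = algebraMap F L p + algebraMap F L q * lam)
    (hcube : ∀ c ∈ F⟮lam⟯, c ^ 3 ≠ algebraMap F L p + algebraMap F L q * lam) :
    finrank (F⟮(⟨lam, lam_mem⟩ : F⟮lam, y⟯)⟯) F⟮lam, y⟯ = 3 := by
  set N : IntermediateField F L := F⟮lam, y⟯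
  set lam' : N := ⟨lam, lam_mem⟩ with hlam'
  set y' : N := ⟨y, y_mem⟩ with hy'
  set M : IntermediateField F N := F⟮lam'⟯ with hM
  -- the radicand as an element of `M`
  have he_mem : algebraMap F N p + algebraMap F N q * lam' ∈ M :=
    add_mem (IntermediateField.algebraMap_mem _ p)
      (mul_mem (IntermediateField.algebraMap_mem _ q) (mem_adjoin_simple_self F lam'))
  set e₁ : M := ⟨algebraMap F N p + algebraMap F N q * lam', he_mem⟩ with he₁
  have he₁L : (((e₁ : M) : N) : L) = algebraMap F L p + algebraMap F L q * lam := rfl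
  -- `y'` is a root of `X³ − e₁`
  have hroot : aeval y' (X ^ 3 - C e₁ : M[X]) = 0 := by
    rw [map_sub, aeval_X_pow, aeval_C]
    apply Subtype.ext
    change (y : L) ^ 3 - (((e₁ : M) : N) : L) = 0
    rw [he₁L, hy, sub_self]
  -- irreducibility
  have hirr : Irreducible (X ^ 3 - C e₁ : M[X]) := by
    refine (X_pow_sub_C_irreducible_iff_of_prime Nat.prime_three).mpr fun b hb => ?_
    apply hcube ((b : N) : L) (coe_mem_adjoin_lam_of_mem b.2)
    have := congrArg (fun t : M => (((t : M) : N) : L)) hb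
    simpa [he₁L] using this
  have hint : IsIntegral M y' := ⟨X ^ 3 - C e₁, monic_X_pow_sub_C e₁ three_ne_zero, by
    rwa [← aeval_def]⟩
  have hmin : minpoly M y' = X ^ 3 - C e₁ :=
    (minpoly.eq_of_irreducible_of_monic hirr hroot (monic_X_pow_sub_C e₁ three_ne_zero)).symm
  rw [← finrank_top', ← adjoin_adjoin_lam_y_eq_top, adjoin.finrank hint, hmin, natDegree_X_pow_sub_C]

/-- **`[F(λ, y) : F] = 6`.** [folklore] -/
theorem finrank_adjoin_pair (hlam : lam ^ 2 = -3) (hlamF : ∀ x : F, algebraMap F L x ≠ lam)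
    (hy : y ^ 3 = algebraMap F L p + algebraMap F L q * lam)
    (hcube : ∀ c ∈ F⟮lam⟯, c ^ 3 ≠ algebraMap F L p + algebraMap F L q * lam) :
    finrank F F⟮lam, y⟯ = 6 := by
  rw [← Module.finrank_mul_finrank F (F⟮(⟨lam, lam_mem⟩ : F⟮lam, y⟯)⟯) F⟮lam, y⟯,
    finrank_adjoin_lam_internal hlam hlamF, finrank_adjoin_lam_top hy hcube]

/-! ### The Galois group is abelian

We phrase the statements for arbitrary elements `lam' y' : F⟮lam, y⟯` lying over `λ, y`. -/

/-- `λ'² = −3` inside `N`. [folklore] -/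
theorem lam'_sq (hlam : lam ^ 2 = -3) {lam' : F⟮lam, y⟯} (hl : (lam' : L) = lam) :
    lam' ^ 2 = -3 :=
  Subtype.ext (by rw [SubmonoidClass.coe_pow, hl, hlam]; rfl)

/-- An `F`-automorphism of `N` sends `λ'` to `±λ'`. [folklore] -/
theorem gal_apply_lam (hlam : lam ^ 2 = -3) {lam' : F⟮lam, y⟯} (hl : (lam' : L) = lam)
    (σ : F⟮lam, y⟯ ≃ₐ[F] F⟮lam, y⟯) : σ lam' = lam' ∨ σ lam' = -lam' := by
  have h2 : (σ lam') ^ 2 = -3 := by rw [← map_pow, lam'_sq hlam hl, map_neg, map_ofNat]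
  have h : (σ lam' - lam') * (σ lam' + lam') = 0 := by
    linear_combination h2 - lam'_sq hlam hl
  rcases mul_eq_zero.mp h with h | h
  · exact Or.inl (sub_eq_zero.mp h)
  · exact Or.inr (eq_neg_of_add_eq_zero_left h)

/-- A cube root of unity of `N`, in coordinates: `ω = u + vλ'`, `(u + vλ')(u − vλ') = 1`. [folklore] -/
theorem exists_coords_of_cube_eq_one' [CharZero F] [CharZero L] (hlam : lam ^ 2 = -3)
    {lam' : F⟮lam, y⟯} (hl : (lam' : L) = lam) {ω : F⟮lam, y⟯} (hω : ω ^ 3 = 1) :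
    ∃ u v : F, ω = algebraMap F _ u + algebraMap F _ v * lam' ∧
      (algebraMap F F⟮lam, y⟯ u + algebraMap F _ v * lam') *
        (algebraMap F _ u - algebraMap F _ v * lam') = 1 := by
  obtain ⟨u, v, huv, h1⟩ := exists_coords_of_cube_eq_one (F := F) (lam'_sq hlam hl) hω
  refine ⟨u, v, huv, ?_⟩
  have h1' := congrArg (algebraMap F F⟮lam, y⟯) h1
  rw [map_add, map_mul, map_pow, map_pow, map_ofNat, map_one] at h1'
  linear_combination h1' - (algebraMap F F⟮lam, y⟯ v) ^ 2 * lam'_sq hlam hl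

/-- `y'³ = p + qλ'` inside `N`. [folklore] -/
theorem y'_pow_three (hy : y ^ 3 = algebraMap F L p + algebraMap F L q * lam)
    {lam' y' : F⟮lam, y⟯} (hl : (lam' : L) = lam) (hyy : (y' : L) = y) :
    y' ^ 3 = algebraMap F F⟮lam, y⟯ p + algebraMap F _ q * lam' :=
  Subtype.ext (by
    rw [IntermediateField.coe_pow, IntermediateField.coe_add, IntermediateField.coe_mul,
      IntermediateField.coe_algebraMap_apply, IntermediateField.coe_algebraMap_apply, hl, hyy, hy])

/-- `(m/y')³ = p − qλ'` inside `N`. [folklore] -/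
theorem m_div_y'_pow_three (hlam : lam ^ 2 = -3)
    (hy : y ^ 3 = algebraMap F L p + algebraMap F L q * lam) (hnorm : p ^ 2 + 3 * q ^ 2 = m ^ 3)
    (hcube : ∀ c ∈ F⟮lam⟯, c ^ 3 ≠ algebraMap F L p + algebraMap F L q * lam)
    {lam' y' : F⟮lam, y⟯} (hl : (lam' : L) = lam) (hyy : (y' : L) = y) :
    (algebraMap F F⟮lam, y⟯ m / y') ^ 3 = algebraMap F F⟮lam, y⟯ p - algebraMap F _ q * lam' :=
  Subtype.ext (by
    rw [IntermediateField.coe_pow, IntermediateField.coe_div, AddSubgroupClass.coe_sub,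
      IntermediateField.coe_mul, IntermediateField.coe_algebraMap_apply,
      IntermediateField.coe_algebraMap_apply, IntermediateField.coe_algebraMap_apply, hl, hyy]
    exact m_div_y_pow_three hlam hy hnorm hcube)

/-- **The action of an `F`-automorphism on the generators.**  Either `σλ' = λ'` and `σy' = ωy'`, or
`σλ' = −λ'` and `σy' = ω·m/y'`, with `ω = u + vλ'` a cube root of unity (`(u+vλ')(u−vλ') = 1`).
[folklore] -/
theorem gal_apply_gens [CharZero F] [CharZero L] (hlam : lam ^ 2 = -3)
    (hlamF : ∀ x : F, algebraMap F L x ≠ lam)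
    (hy : y ^ 3 = algebraMap F L p + algebraMap F L q * lam) (hnorm : p ^ 2 + 3 * q ^ 2 = m ^ 3)
    (hcube : ∀ c ∈ F⟮lam⟯, c ^ 3 ≠ algebraMap F L p + algebraMap F L q * lam)
    {lam' y' : F⟮lam, y⟯} (hl : (lam' : L) = lam) (hyy : (y' : L) = y)
    (σ : F⟮lam, y⟯ ≃ₐ[F] F⟮lam, y⟯) :
    ∃ u v : F,
      (algebraMap F F⟮lam, y⟯ u + algebraMap F _ v * lam') * (algebraMap F _ u - algebraMap F _ v * lam') = 1 ∧
      ((σ lam' = lam' ∧ σ y' = (algebraMap F _ u + algebraMap F _ v * lam') * y') ∨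
        (σ lam' = -lam' ∧ σ y' = (algebraMap F _ u + algebraMap F _ v * lam') * (algebraMap F _ m / y'))) := by
  have hyN := y'_pow_three hy hl hyy
  have hy0 : y' ≠ 0 := fun h => y_ne_zero hy hcube (by rw [← hyy, h]; rfl)
  have hmyN := m_div_y'_pow_three hlam hy hnorm hcube hl hyy
  rcases gal_apply_lam hlam hl σ with hσ | hσ
  · -- `σλ' = λ'`: `(σy')³ = e = y'³`
    have h3 : (σ y') ^ 3 = y' ^ 3 := by
      rw [← map_pow, hyN, map_add, map_mul, AlgEquiv.commutes, AlgEquiv.commutes, hσ]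
    obtain ⟨ω, hω, hωy⟩ := exists_cube_root_one_mul hy0 h3
    obtain ⟨u, v, rfl, h1⟩ := exists_coords_of_cube_eq_one' hlam hl hω
    exact ⟨u, v, h1, Or.inl ⟨hσ, hωy⟩⟩
  · -- `σλ' = -λ'`: `(σy')³ = ē = (m/y')³`
    have hmy0 : algebraMap F F⟮lam, y⟯ m / y' ≠ 0 := by
      intro h0
      rw [h0, zero_pow three_ne_zero] at hmyN
      apply ebar_ne_zero hlamF hcube
      have := congrArg Subtype.val hmyN
      rw [AddSubgroupClass.coe_sub, IntermediateField.coe_mul, IntermediateField.coe_algebraMap_apply,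
        IntermediateField.coe_algebraMap_apply, hl] at this
      exact this.symm
    have h3 : (σ y') ^ 3 = (algebraMap F F⟮lam, y⟯ m / y') ^ 3 := by
      rw [← map_pow, hyN, map_add, map_mul, AlgEquiv.commutes, AlgEquiv.commutes, hσ, hmyN]
      ring
    obtain ⟨ω, hω, hωy⟩ := exists_cube_root_one_mul hmy0 h3
    obtain ⟨u, v, rfl, h1⟩ := exists_coords_of_cube_eq_one' hlam hl hω
    exact ⟨u, v, h1, Or.inr ⟨hσ, hωy⟩⟩

/-- **`Gal(F(λ, y)/F)` is abelian.**  Check `στ = τσ` on the generators `λ', y'` using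
`gal_apply_gens`: on `λ'` both give `±±λ'`; on `y'` the four sign cases reduce to
`(u + vλ')(u − vλ') = 1` for the cube roots of unity involved. [folklore] -/
theorem mul_comm_gal [CharZero F] [CharZero L] (hlam : lam ^ 2 = -3)
    (hlamF : ∀ x : F, algebraMap F L x ≠ lam)
    (hy : y ^ 3 = algebraMap F L p + algebraMap F L q * lam) (hnorm : p ^ 2 + 3 * q ^ 2 = m ^ 3)
    (hcube : ∀ c ∈ F⟮lam⟯, c ^ 3 ≠ algebraMap F L p + algebraMap F L q * lam)
    (σ τ : F⟮lam, y⟯ ≃ₐ[F] F⟮lam, y⟯) : σ * τ = τ * σ := by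
  apply AlgEquiv.coe_toAlgHom_injective
  apply adjoin_algHom_ext F (s := ({lam, y} : Set L))
  intro x hx
  change σ (τ ⟨x, _⟩) = τ (σ ⟨x, _⟩)
  rcases (show x = lam ∨ x ∈ ({y} : Set L) from hx) with hxl | hxy
  · -- the generator `λ'`
    rcases gal_apply_lam hlam (lam' := ⟨x, subset_adjoin F _ hx⟩) hxl σ with hσ | hσ <;>
      rcases gal_apply_lam hlam (lam' := ⟨x, subset_adjoin F _ hx⟩) hxl τ with hτ | hτ <;>
      simp only [hσ, hτ, map_neg, neg_neg]
  · -- the generator `y'`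
    rw [Set.mem_singleton_iff] at hxy
    have hl : ((⟨lam, lam_mem⟩ : F⟮lam, y⟯) : L) = lam := rfl
    have hy0 : (⟨x, subset_adjoin F _ hx⟩ : F⟮lam, y⟯) ≠ 0 := fun h =>
      y_ne_zero hy hcube (by rw [← hxy]; exact congrArg Subtype.val h)
    have hm0 : algebraMap F F⟮lam, y⟯ m ≠ 0 := by
      intro h0
      have h3 := m_div_y'_pow_three (y' := ⟨x, subset_adjoin F _ hx⟩) hlam hy hnorm hcube hl hxy
      rw [h0, zero_div, zero_pow three_ne_zero] at h3
      apply ebar_ne_zero hlamF hcube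
      have := congrArg Subtype.val h3
      rw [AddSubgroupClass.coe_sub, IntermediateField.coe_mul, IntermediateField.coe_algebraMap_apply,
        IntermediateField.coe_algebraMap_apply] at this
      exact this.symm
    obtain ⟨u₁, v₁, h1σ, hσ⟩ :=
      gal_apply_gens (y' := ⟨x, subset_adjoin F _ hx⟩) hlam hlamF hy hnorm hcube hl hxy σ
    obtain ⟨u₂, v₂, h1τ, hτ⟩ :=
      gal_apply_gens (y' := ⟨x, subset_adjoin F _ hx⟩) hlam hlamF hy hnorm hcube hl hxy τ
    -- how `σ, τ` act on the cube roots of unity `ωᵢ = uᵢ + vᵢλ'`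
    have hfix : ∀ (ρ : F⟮lam, y⟯ ≃ₐ[F] F⟮lam, y⟯) (u v : F), ρ ⟨lam, lam_mem⟩ = ⟨lam, lam_mem⟩ →
        ρ (algebraMap F F⟮lam, y⟯ u + algebraMap F _ v * ⟨lam, lam_mem⟩) =
          algebraMap F F⟮lam, y⟯ u + algebraMap F _ v * ⟨lam, lam_mem⟩ := fun ρ u v h => by
      rw [map_add, map_mul, AlgEquiv.commutes, AlgEquiv.commutes, h]
    have hflip : ∀ (ρ : F⟮lam, y⟯ ≃ₐ[F] F⟮lam, y⟯) (u v : F), ρ ⟨lam, lam_mem⟩ = -⟨lam, lam_mem⟩ →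
        ρ (algebraMap F F⟮lam, y⟯ u + algebraMap F _ v * ⟨lam, lam_mem⟩) =
          algebraMap F F⟮lam, y⟯ u - algebraMap F _ v * ⟨lam, lam_mem⟩ := fun ρ u v h => by
      rw [map_add, map_mul, AlgEquiv.commutes, AlgEquiv.commutes, h]; ring
    set ω₁ := algebraMap F F⟮lam, y⟯ u₁ + algebraMap F _ v₁ * ⟨lam, lam_mem⟩ with hω₁
    set ω₁' := algebraMap F F⟮lam, y⟯ u₁ - algebraMap F _ v₁ * ⟨lam, lam_mem⟩ with hω₁'
    set ω₂ := algebraMap F F⟮lam, y⟯ u₂ + algebraMap F _ v₂ * ⟨lam, lam_mem⟩ with hω₂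
    set ω₂' := algebraMap F F⟮lam, y⟯ u₂ - algebraMap F _ v₂ * ⟨lam, lam_mem⟩ with hω₂'
    set m' := algebraMap F F⟮lam, y⟯ m with hm'
    set y' : F⟮lam, y⟯ := ⟨x, subset_adjoin F _ hx⟩ with hy'
    have hω₁0 : ω₁ ≠ 0 := left_ne_zero_of_mul_eq_one h1σ
    have hω₂0 : ω₂ ≠ 0 := left_ne_zero_of_mul_eq_one h1τ
    have hσm : σ m' = m' := AlgEquiv.commutes σ m
    have hτm : τ m' = m' := AlgEquiv.commutes τ m
    rcases hσ with ⟨hσl, hσy⟩ | ⟨hσl, hσy⟩ <;> rcases hτ with ⟨hτl, hτy⟩ | ⟨hτl, hτy⟩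
    · have hσω : σ ω₂ = ω₂ := hfix σ u₂ v₂ hσl
      have hτω : τ ω₁ = ω₁ := hfix τ u₁ v₁ hτl
      clear_value ω₁ ω₁' ω₂ ω₂' m' y'
      rw [hτy, map_mul, hσω, hσy, map_mul, hτω, hτy]
      ring
    · have hσω : σ ω₂ = ω₂ := hfix σ u₂ v₂ hσl
      have hτω : τ ω₁ = ω₁' := hflip τ u₁ v₁ hτl
      clear_value ω₁ ω₁' ω₂ ω₂' m' y'
      rw [hτy, map_mul, map_div₀, hσω, hσm, hσy, map_mul, hτω, hτy]
      field_simp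
      linear_combination (-1 : F⟮lam, y⟯) * h1σ
    · have hσω : σ ω₂ = ω₂' := hflip σ u₂ v₂ hσl
      have hτω : τ ω₁ = ω₁ := hfix τ u₁ v₁ hτl
      clear_value ω₁ ω₁' ω₂ ω₂' m' y'
      rw [hτy, map_mul, hσω, hσy, map_mul, map_div₀, hτω, hτm, hτy]
      field_simp
      linear_combination h1τ
    · have hσω : σ ω₂ = ω₂' := hflip σ u₂ v₂ hσl
      have hτω : τ ω₁ = ω₁' := hflip τ u₁ v₁ hτl
      clear_value ω₁ ω₁' ω₂ ω₂' m' y'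
      rw [hτy, map_mul, map_div₀, hσω, hσm, hσy, map_mul, map_div₀, hτω, hτm, hτy]
      field_simp
      linear_combination h1τ - h1σ

/-- **The cubic subfield.**  `F(λ, y)/F` is abelian of degree `6`; the fixed field of an element of
order `2` of its Galois group is a (cyclic) cubic Galois extension `E/F` inside `F(λ, y)`.
This is the field cut out by the character of order `3` in the proof of
[cite: Washington1997, Thm 10.10]. -/
theorem exists_cubic_galois_intermediateField [IsAlgClosed L] [CharZero F] [CharZero L]
    (hlam : lam ^ 2 = -3) (hlamF : ∀ x : F, algebraMap F L x ≠ lam)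
    (hy : y ^ 3 = algebraMap F L p + algebraMap F L q * lam) (hnorm : p ^ 2 + 3 * q ^ 2 = m ^ 3)
    (hcube : ∀ c ∈ F⟮lam⟯, c ^ 3 ≠ algebraMap F L p + algebraMap F L q * lam) :
    ∃ E : IntermediateField F F⟮lam, y⟯, IsGalois F E ∧ finrank F E = 3 := by
  haveI := isGalois_adjoin_pair hlam hlamF hy hnorm hcube
  haveI := finiteDimensional_adjoin_pair hlam hy hnorm
  have h6 := finrank_adjoin_pair hlam hlamF hy hcube
  have hcard : Nat.card (F⟮lam, y⟯ ≃ₐ[F] F⟮lam, y⟯) = 6 := by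
    rw [IsGalois.card_aut_eq_finrank, h6]
  haveI : Fact (Nat.Prime 2) := ⟨Nat.prime_two⟩
  obtain ⟨g, hg⟩ := exists_prime_orderOf_dvd_card' (G := F⟮lam, y⟯ ≃ₐ[F] F⟮lam, y⟯) 2
    (by rw [hcard]; norm_num)
  haveI hN : (Subgroup.zpowers g).Normal :=
    ⟨fun n hn k => by rwa [mul_comm_gal hlam hlamF hy hnorm hcube k n, mul_inv_cancel_right]⟩
  refine ⟨fixedField (Subgroup.zpowers g), IsGalois.of_fixedField_normal_subgroup _, ?_⟩
  have h2 : finrank (fixedField (Subgroup.zpowers g)) F⟮lam, y⟯ = 2 := by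
    rw [finrank_fixedField_eq_card, Nat.card_zpowers, hg]
  have hmul := Module.finrank_mul_finrank F (fixedField (Subgroup.zpowers g)) F⟮lam, y⟯
  rw [h2, h6] at hmul
  omega

end Setup

end KummerSextic

end Literature.NumberTheory.NumberFields

end
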